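import Summits.ResolutionOfSingularities.ResolutionOfSingularities.Theorems.EquisingularLiftEquisingularLiftNatOrdinaryPoint
import Summits.ResolutionOfSingularities.ResolutionOfSingularities.Theorems.EquisingularLiftEquisingularLiftNatLinearCentreBlowupPointwise
import HarnessLib

/-!
# [OURS · L1 W4.5(b)] AN ORDINARY MULTIPLE POINT AT AN ARBITRARY COORDINATE VERTEX `P_c`, ANY DIMENSION: the vertex chart transported to
# `ChartRing F c`, and regularity of every blow-up of `H` along the point AT THE POINTS OVER IT
# (crux `Theses.EquisingularLift.EquisingularLiftNat`, stmt-ResolutionOfSingularities-20038)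

NOT a statement of any manuscript; OURS kernel lemmas (cell `res-hironaka`, chain w45b; seat res-D-pv-013, own initiative, counted 0). AI-written,
weaker than expert review. No definition, no `sorry`, standard axioms.

`…NatOrdinaryPoint` (p545486/p547093, T-ORD) treats ONE ordinary multiple point at the vertex `P₀ = [1:0:…:0]` and concludes `ELNatAt` when `H` is
regular elsewhere. For SEVERAL ordinary points (the MULTI-POINT rung: one horizontal E1 step along the product of the point centres) one needs the same
analysis at every coordinate vertex `P_c = [0:…:1_c:…:0]` and in POINTWISE form (no hypothesis on `H` away from `P_c`):

* `OrdPointAt.not_mem_range_iff` — for `e : Fin 1 → Fin (m+3)`, `e _ = c`: `a ∉ range e ↔ a ≠ c`;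
* `OrdPointAt.radical_span_dehomogenize_eq` — `(F(x_c := 1))` is radical for a prime form `F` with `F(x_c:=1) = Φ + Ψ`, `μ ≥ 1`;
* `OrdPointAt.mem_span_X_succAbove` — such an `F` lies in `(x_a : a ≠ c)` (the vertex `P_c` lies on `H`);
* **`OrdPointAt.isRegularLocalRing_localization_blowupAlgebra_chartRing`** — `F(x_c := 1) = Φ + Ψ`, `Φ` a nonsingular form of degree `μ`,
  `Ψ ∈ (y)^{μ+1}`: the localisations of `(ChartRing F c)[I/(x_a/x_c)]`, `I = (x_{a'}/x_c : a' ≠ c)`, at the primes containing `x_a/x_c` are regular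
  (`OrdPoint.isRegularLocalRing_localization_blowupAlgebra`, p544429, transported along `ChartRing F c ≅ K[y]/(Φ + Ψ)` with the `c.succAbove` indexing);
* **`OrdPointAt.isRegularLocalRing_stalk_of_isBlowup_comap`** — hence for EVERY blow-up `ρ : Z → H` along `Λ_c·𝒪_H` (`Λ_c = ker Proj(f_k)` the
  point `P_c`) and every `z` over `supp(Λ_c·𝒪_H)`, `𝒪_{Z,z}` is regular (`HypersurfaceSpecimen.isRegularLocalRing_stalk_of_isBlowup_comap_of_mem_support`).

References: Hartshorne I Thm. 5.1, II Prop. 5.9; The Stacks Project 0804, 0BIQ; Görtz–Wedhorn I 13.96 — through the cited tree files.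
-/

set_option linter.dupNamespace false -- mandated namespace `Summit.<Summit>.<Problem>` of this single-conjunct summit

noncomputable section

open CategoryTheory CategoryTheory.Limits AlgebraicGeometry TopologicalSpace
open MvPolynomial HomogeneousLocalization
open Literature.AlgebraicGeometry.Resolution
open Literature.AlgebraicGeometry.Motives Literature.AlgebraicGeometry.Motives.SmoothHypersurface
open Literature.AlgebraicGeometry.Motives.ProjectiveSpace
open AlgebraicGeometry.Scheme.IdealSheafData
open Summit.ResolutionOfSingularities.ResolutionOfSingularities.Cruxes.EquisingularLift.StrataSplit

namespace Summit.ResolutionOfSingularities.ResolutionOfSingularities.Cruxes.EquisingularLiftNat.Sections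

namespace OrdPointAt

variable (k : Type) [Field k] {m : ℕ} (F : MvPolynomial (Fin (m + 2 + 1)) k) {d : ℕ} (c : Fin (m + 2 + 1))

attribute [local instance] MvPolynomial.gradedAlgebra ProjBaseChange.algebraBase

/-! ## Bookkeeping at the vertex `P_c` -/

omit [Field k] in
/-- For the vertex map `e : Fin 1 → Fin (m+3)`, `e _ = c`: `a ∉ range e ↔ a ≠ c`. [folklore] -/
theorem not_mem_range_iff {e : Fin 1 → Fin (m + 2 + 1)} (hec : ∀ j, e j = c) (a : Fin (m + 2 + 1)) :
    a ∉ Set.range e ↔ a ≠ c := by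
  constructor
  · rintro h rfl
    exact h ⟨0, hec 0⟩
  · rintro h ⟨j, rfl⟩
    exact h (hec j)

/-- **`(F(x_c := 1))` is radical** for a prime form `F` with vertex chart `F(x_c := 1) = Φ + Ψ`, `Φ` a form of degree `μ ≥ 1`, `Ψ ∈ (y)^{μ+1}`:
`F(x_c:=1)` is irreducible or a unit (tree `irreducible_or_isUnit_dehomogenize`), and not a unit since it lies in `(y)`. [cite: Hartshorne1977, I §2, Ex. 2.10] -/
theorem radical_span_dehomogenize_eq (hF : F.IsHomogeneous d) (hFp : Prime F) (Φ Ψ : MvPolynomial (Fin (m + 2)) k) {μ : ℕ} (hΦ : Φ.IsHomogeneous μ) (hμ : 1 ≤ μ)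
    (hΨ : Ψ ∈ Ideal.span (Set.range (X : Fin (m + 2) → MvPolynomial (Fin (m + 2)) k)) ^ (μ + 1))
    (hdeh : dehomogenize k c F = Φ + Ψ) : (Ideal.span {Φ + Ψ}).radical = Ideal.span {Φ + Ψ} := by
  have hmem : Φ + Ψ ∈ Ideal.span (Set.range (X : Fin (m + 2) → MvPolynomial (Fin (m + 2)) k)) :=
    Ideal.add_mem _ (OrdPoint.mem_span_X_of_isHomogeneous k Φ hΦ hμ) (Ideal.pow_le_self (by omega) hΨ)
  have hnu : ¬ IsUnit (Φ + Ψ) := by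
    intro hu
    have htop := Ideal.eq_top_of_isUnit_mem _ hmem hu
    have hprime : (Ideal.span (Set.range (X : Fin (m + 2) → MvPolynomial (Fin (m + 2)) k))).IsPrime :=
      (Ideal.Quotient.isDomain_iff_prime _).mp (ConeN.isDomain_quotient_origin k (N := m + 1))
    exact hprime.ne_top htop
  have hirr : Irreducible (Φ + Ψ) := by
    rw [← hdeh] at hnu ⊢
    exact (irreducible_or_isUnit_dehomogenize (i := c) hF hFp.irreducible).resolve_right hnu
  exact ((Ideal.span_singleton_prime hirr.ne_zero).mpr hirr.prime).radical

/-- **The vertex `P_c` lies on `H`**: a form `F` whose chart `F(x_c := 1)` has no constant term lies in `(x_a : a ≠ c)` — its only monomial free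
of the other variables would be `x_c^d`, whose coefficient is `F(x_c := 1)(0) = 0`. [folklore] -/
theorem mem_span_X_succAbove (hF : F.IsHomogeneous d) (Φ Ψ : MvPolynomial (Fin (m + 2)) k) {μ : ℕ} (hΦ : Φ.IsHomogeneous μ) (hμ : 1 ≤ μ)
    (hΨ : Ψ ∈ Ideal.span (Set.range (X : Fin (m + 2) → MvPolynomial (Fin (m + 2)) k)) ^ (μ + 1))
    (hdeh : dehomogenize k c F = Φ + Ψ) :
    F ∈ Ideal.span (Set.range fun j : Fin (m + 2) => (X (c.succAbove j) : MvPolynomial (Fin (m + 2 + 1)) k)) := by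
  classical
  -- the constant term of `F(x_c := 1)` vanishes
  have hmem : Φ + Ψ ∈ Ideal.span (Set.range (X : Fin (m + 2) → MvPolynomial (Fin (m + 2)) k)) :=
    Ideal.add_mem _ (OrdPoint.mem_span_X_of_isHomogeneous k Φ hΦ hμ) (Ideal.pow_le_self (by omega) hΨ)
  have heval0 : eval (fun _ : Fin (m + 2) => (0 : k)) (dehomogenize k c F) = 0 := by
    rw [hdeh]
    have hle : Ideal.span (Set.range (X : Fin (m + 2) → MvPolynomial (Fin (m + 2)) k)) ≤
        RingHom.ker (eval (fun _ : Fin (m + 2) => (0 : k))) := by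
      rw [Ideal.span_le]
      rintro _ ⟨i, rfl⟩
      simp
    exact hle hmem
  -- hence `F(P_c) = 0`, i.e. the coefficient of `x_c^d` vanishes
  have hevalF : eval (Pi.single c (1 : k)) F = 0 := by
    rw [← eval_dehomogenize c (Pi.single c (1 : k)) (by simp) F]
    have hz : (fun j : Fin (m + 2) => Pi.single (M := fun _ => k) c (1 : k) (c.succAbove j)) = fun _ => 0 := by
      funext j
      exact Pi.single_eq_of_ne (Fin.succAbove_ne c j) _
    rw [hz, heval0]
  -- a monomial of `F` vanishing off `c` is `x_c^d`
  have hsingle : ∀ b ∈ F.support, (∀ a, a ≠ c → b a = 0) → b = Finsupp.single c d := by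
    intro b hb hall
    have hsub : b.support ⊆ {c} := fun a ha => by
      rw [Finset.mem_singleton]
      by_contra hac
      exact (Finsupp.mem_support_iff.mp ha) (hall a hac)
    have hb' : b = Finsupp.single c (b c) := Finsupp.support_subset_singleton.mp hsub
    have hw : Finsupp.weight (1 : Fin (m + 2 + 1) → ℕ) b = d := hF (mem_support_iff.mp hb)
    rw [hb', Finsupp.weight_single, Pi.one_apply, smul_eq_mul, mul_one] at hw
    rw [hb', hw]
  -- `F(P_c)` is the coefficient of `x_c^d`
  have hev : eval (Pi.single c (1 : k)) F = F.coeff (Finsupp.single c d) := by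
    rw [eval_eq', Finset.sum_eq_single (Finsupp.single c d)]
    · rw [Finset.prod_eq_one (fun i _ => ?_), mul_one]
      by_cases hic : i = c
      · subst hic
        simp
      · rw [Pi.single_eq_of_ne hic, Finsupp.single_eq_of_ne hic, pow_zero]
    · intro b hb hne
      have hex : ∃ a, a ≠ c ∧ b a ≠ 0 := by
        by_contra hall
        push Not at hall
        exact hne (hsingle b hb hall)
      obtain ⟨a, hac, hba⟩ := hex
      rw [Finset.prod_eq_zero (Finset.mem_univ a) (by rw [Pi.single_eq_of_ne hac, zero_pow hba]), mul_zero]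
    · intro h
      rw [MvPolynomial.notMem_support_iff.mp h, zero_mul]
  have hcoeff : F.coeff (Finsupp.single c d) = 0 := by rw [← hev, hevalF]
  have hrange : (Set.range fun j : Fin (m + 2) => (X (c.succAbove j) : MvPolynomial (Fin (m + 2 + 1)) k)) =
      X '' {a : Fin (m + 2 + 1) | a ≠ c} := by
    ext q
    constructor
    · rintro ⟨j, rfl⟩
      exact ⟨c.succAbove j, Fin.succAbove_ne c j, rfl⟩
    · rintro ⟨a, ha, rfl⟩
      obtain ⟨j, rfl⟩ := Fin.exists_succAbove_eq ha
      exact ⟨j, rfl⟩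
  rw [hrange, MvPolynomial.mem_ideal_span_X_image]
  intro b hb
  by_contra hall
  push Not at hall
  have hb' := hsingle b hb fun a ha => hall a ha
  rw [hb'] at hb
  exact (mem_support_iff.mp hb) hcoeff

/-! ## The vertex chart, transported to `ChartRing F c` -/

/-- **THE VERTEX CHART OF AN ORDINARY POINT, on `ChartRing F c`** (any vertex `c`): if `F(x_c := 1) = Φ + Ψ` with `Φ` a nonsingular form of degree
`μ` and `Ψ ∈ (y)^{μ+1}`, `(Φ + Ψ)` radical, then for the centre `I = (x_a/x_c : a ≠ c)` of `ChartRing F c` and `b = x_a/x_c` the localisations of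
`(ChartRing F c)[I/b]` at the primes containing `b` are regular — `OrdPoint.isRegularLocalRing_localization_blowupAlgebra` (p544429) transported along
`ChartRing F c ≅ K[y]/(Φ + Ψ)` (`HypersurfaceSpecimen.exists_chartQuotEquiv`, `x_{c.succAbove j}/x_c ↦ y_j`; `blowupAlgebra.congrEquiv`).
[cite: StacksProject, Tag 0BIQ] -/
theorem isRegularLocalRing_localization_blowupAlgebra_chartRing (hF : F.IsHomogeneous d) {e : Fin 1 → Fin (m + 2 + 1)} (hec : ∀ j, e j = c)
    (Φ Ψ : MvPolynomial (Fin (m + 2)) k) {μ : ℕ} (hΦ : Φ.IsHomogeneous μ) (hns : IsNonsingularForm k Φ)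
    (hΨ : Ψ ∈ Ideal.span (Set.range (X : Fin (m + 2) → MvPolynomial (Fin (m + 2)) k)) ^ (μ + 1))
    (hdeh : dehomogenize k c F = Φ + Ψ) (hrad : (Ideal.span {Φ + Ψ}).radical = Ideal.span {Φ + Ψ})
    (a : {a : Fin (m + 2 + 1) // a ∉ Set.range e})
    (𝔐 : Ideal (blowupAlgebra (Ideal.span (Set.range fun a' : {a' : Fin (m + 2 + 1) // a' ∉ Set.range e} => tautVec F c hF a'.1))
      (tautVec F c hF a.1))) [𝔐.IsPrime]
    (h𝔐 : algebraMap (ChartRing F c hF) (blowupAlgebra (Ideal.span (Set.range fun a' : {a' : Fin (m + 2 + 1) // a' ∉ Set.range e} =>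
      tautVec F c hF a'.1)) (tautVec F c hF a.1)) (tautVec F c hF a.1) ∈ 𝔐) :
    IsRegularLocalRing (Localization.AtPrime 𝔐) := by
  obtain ⟨θ, hθ⟩ := HypersurfaceSpecimen.exists_chartQuotEquiv F hF c (Φ + Ψ) hdeh hrad
  have hac : a.1 ≠ c := (not_mem_range_iff c hec a.1).mp a.2
  obtain ⟨l₀, hl₀⟩ : ∃ j : Fin (m + 2), c.succAbove j = a.1 := Fin.exists_succAbove_eq hac
  -- the centre and the generator under `θ`
  have hrange : Set.range (⇑θ.toRingHom ∘ fun a' : {a' : Fin (m + 2 + 1) // a' ∉ Set.range e} => tautVec F c hF a'.1) =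
      Set.range (⇑(Ideal.Quotient.mk (Ideal.span {Φ + Ψ})) ∘ (MvPolynomial.X : Fin (m + 2) → MvPolynomial (Fin (m + 2)) k)) := by
    ext q
    constructor
    · rintro ⟨⟨a', ha'⟩, rfl⟩
      obtain ⟨i, rfl⟩ : ∃ i : Fin (m + 2), c.succAbove i = a' :=
        Fin.exists_succAbove_eq ((not_mem_range_iff c hec a').mp ha')
      exact ⟨i, (hθ i).symm⟩
    · rintro ⟨i, rfl⟩
      exact ⟨⟨c.succAbove i, (not_mem_range_iff c hec _).mpr (Fin.succAbove_ne c i)⟩, hθ i⟩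
  have hIθ : (Ideal.span (Set.range fun a' : {a' : Fin (m + 2 + 1) // a' ∉ Set.range e} => tautVec F c hF a'.1)).map θ.toRingHom =
      (Ideal.span (Set.range (X : Fin (m + 2) → MvPolynomial (Fin (m + 2)) k))).map (Ideal.Quotient.mk (Ideal.span {Φ + Ψ})) := by
    rw [Ideal.map_span, Ideal.map_span, ← Set.range_comp, hrange, Set.range_comp]
  have hbθ : θ (tautVec F c hF a.1) = Ideal.Quotient.mk (Ideal.span {Φ + Ψ}) (X l₀) := by
    rw [← hl₀]
    exact hθ l₀
  -- the vertex chart statement for arbitrary indices equal to the transported ones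
  have key : ∀ (J : Ideal (MvPolynomial (Fin (m + 2)) k ⧸ Ideal.span {Φ + Ψ})) (b : MvPolynomial (Fin (m + 2)) k ⧸ Ideal.span {Φ + Ψ}),
      J = (Ideal.span (Set.range (X : Fin (m + 2) → MvPolynomial (Fin (m + 2)) k))).map (Ideal.Quotient.mk (Ideal.span {Φ + Ψ})) →
      b = Ideal.Quotient.mk (Ideal.span {Φ + Ψ}) (X l₀) →
      ∀ (𝔑 : Ideal (blowupAlgebra J b)) [𝔑.IsPrime], algebraMap _ (blowupAlgebra J b) b ∈ 𝔑 →
        IsRegularLocalRing (Localization.AtPrime 𝔑) := by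
    rintro J b rfl rfl 𝔑 _ h𝔑
    exact OrdPoint.isRegularLocalRing_localization_blowupAlgebra k Φ hΦ hns Ψ hΨ l₀ 𝔑 h𝔑
  -- transport along `congrEquiv θ`
  let η := blowupAlgebra.congrEquiv θ (Ideal.span (Set.range fun a' : {a' : Fin (m + 2 + 1) // a' ∉ Set.range e} => tautVec F c hF a'.1))
    (tautVec F c hF a.1)
  obtain ⟨𝔑, h𝔑⟩ : ∃ P, P = 𝔐.comap η.symm.toRingHom := ⟨_, rfl⟩
  haveI : 𝔑.IsPrime := by rw [h𝔑]; exact Ideal.comap_isPrime _ 𝔐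
  have h𝔑mem : algebraMap _ (blowupAlgebra ((Ideal.span (Set.range fun a' : {a' : Fin (m + 2 + 1) // a' ∉ Set.range e} =>
      tautVec F c hF a'.1)).map θ.toRingHom) (θ (tautVec F c hF a.1))) (θ (tautVec F c hF a.1)) ∈ 𝔑 := by
    rw [h𝔑, Ideal.mem_comap]
    change η.symm _ ∈ 𝔐
    rw [blowupAlgebra.congrEquiv_symm_algebraMap, RingEquiv.symm_apply_apply]
    exact h𝔐
  have hreg := key _ _ hIθ hbθ 𝔑 h𝔑mem
  exact OrdPoint.isRegularLocalRing_localization_of_ringEquiv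
    (C := blowupAlgebra ((Ideal.span (Set.range fun a' : {a' : Fin (m + 2 + 1) // a' ∉ Set.range e} => tautVec F c hF a'.1)).map
      θ.toRingHom) (θ (tautVec F c hF a.1)))
    (D := blowupAlgebra (Ideal.span (Set.range fun a' : {a' : Fin (m + 2 + 1) // a' ∉ Set.range e} => tautVec F c hF a'.1))
      (tautVec F c hF a.1)) η.symm 𝔑 𝔐 (fun y => by rw [h𝔑, Ideal.mem_comap]; rfl) hreg

/-! ## Regularity of every blow-up of `H` along the point `P_c`, at the points over it -/

/-- **AN ORDINARY MULTIPLE POINT AT THE VERTEX `P_c` IS RESOLVED BY ONE BLOW-UP, POINTWISE** (any `n`, any `c`): `F` a prime form with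
`F(x_c := 1) = Φ + Ψ`, `Φ` a NONSINGULAR form of degree `μ ≥ 1` (smooth projectivised tangent cone) and `Ψ ∈ (y)^{μ+1}`; `Λ_c = ker Proj(f_k)` the point
`P_c` (`e _ = c`). Then for every blow-up `ρ : Z → H = V₊(F)` along `Λ_c·𝒪_H` and every `z` with `ρ z ∈ supp(Λ_c·𝒪_H)` the local ring `𝒪_{Z,z}` is
regular — `HypersurfaceSpecimen.isRegularLocalRing_stalk_of_isBlowup_comap_of_mem_support` with the vertex chart above. No hypothesis on `H` away
from `P_c` (there `H` may have other singular points). [cite: StacksProject, Tag 0804] [cite: Hartshorne1977, I Thm. 5.1] -/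
theorem isRegularLocalRing_stalk_of_isBlowup_comap (hF : F.IsHomogeneous d) (hFp : Prime F) {e : Fin 1 → Fin (m + 2 + 1)}
    (hec : ∀ j, e j = c)
    (fk : homogeneousSubmodule (Fin (m + 2 + 1)) k →+*ᵍ homogeneousSubmodule (Fin (0 + 1)) k)
    (hfk' : HomogeneousIdeal.irrelevant (homogeneousSubmodule (Fin (0 + 1)) k) ≤
      (HomogeneousIdeal.irrelevant (homogeneousSubmodule (Fin (m + 2 + 1)) k)).map fk)
    (hfkC : ∀ a : k, fk (C a) = C a) (hfke : ∀ j : Fin 1, fk (X (e j)) = X j)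
    (hfk0 : ∀ i : Fin (m + 2 + 1), i ∉ Set.range e → fk (X i) = 0)
    (Φ Ψ : MvPolynomial (Fin (m + 2)) k) {μ : ℕ} (hΦ : Φ.IsHomogeneous μ) (hμ : 1 ≤ μ) (hns : IsNonsingularForm k Φ)
    (hΨ : Ψ ∈ Ideal.span (Set.range (X : Fin (m + 2) → MvPolynomial (Fin (m + 2)) k)) ^ (μ + 1))
    (hdeh : dehomogenize k c F = Φ + Ψ)
    {Z : Scheme.{0}} {ρ : Z ⟶ (hypersurface F).left} (hρ : IsBlowup ρ ((Proj.map fk hfk').ker.comap (hypersurfaceι F).left))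
    (z : Z) (hz : ρ z ∈ (((Proj.map fk hfk').ker.comap (hypersurfaceι F).left).support : Set (hypersurface F).left)) :
    IsRegularLocalRing (Z.presheaf.stalk z) := by
  have hd : 0 < d := ConeN.pos_of_prime_of_isHomogeneous k F hF hFp
  have he : Function.Injective e := Function.injective_of_subsingleton e
  have hrad := radical_span_dehomogenize_eq k F c hF hFp Φ Ψ hΦ hμ hΨ hdeh
  refine HypersurfaceSpecimen.isRegularLocalRing_stalk_of_isBlowup_comap_of_mem_support k F hF hd e he fk hfk' hfkC hfke hfk0
    (fun c' hc' a 𝔐 _ h𝔐 => ?_) hρ z hz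
  obtain ⟨j, rfl⟩ := hc'
  have hec' : ∀ j', e j' = e j := fun j' => by rw [hec j', hec j]
  have hdeh' : dehomogenize k (e j) F = Φ + Ψ := by rw [hec j]; exact hdeh
  exact isRegularLocalRing_localization_blowupAlgebra_chartRing k F (e j) hF hec' Φ Ψ hΦ hns hΨ hdeh' hrad a 𝔐 h𝔐

end OrdPointAt

end Summit.ResolutionOfSingularities.ResolutionOfSingularities.Cruxes.EquisingularLiftNat.Sections

end
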